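/-
Origin: expansion seat `planner-pub-hodgecm-pv10-0`, handover #2 2026-08-18T03:58:33Z (`HOME/pub-hodgecm-pv10/lean/Pv10/UnitsNonarchimedean.lean`, md5 442d5acd, 183 lines);
landed by the gen-5 packager in gate run 20 as `HodgeCM/PerL34/UnitsNonarchimedean.lean` (verbatim).
-/
/-
Origin: planner-pub-hodgecm-pv10-0 (unit pub-hodgecm-pv10), HodgeCM publication cell, 2026-08-18.
LEMMAS.md §3 vocabulary D3 / nodes N15 & N31g: the maximal compact subgroup `∏_v 𝒪_v^×` of the finite
ideles has NO SMALL SUBGROUPS OBSTRUCTION, i.e. it is a nonarchimedean group (every neighbourhood of `1`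
contains an open subgroup).  MATHLIB-ONLY.
-/
import Mathlib.Topology.Algebra.Group.Units
import Mathlib.Topology.Algebra.Nonarchimedean.Basic
import Mathlib.Topology.Algebra.OpenSubgroup
import Mathlib.Topology.Algebra.Ring.Basic
import Mathlib.Topology.Algebra.Valued.ValuationTopology
import Mathlib.RingTheory.DedekindDomain.AdicValuation
import Literature.Topology.Algebra.UnitsNonarchimedean

/-!
# Units of valuation rings and of their products are nonarchimedean groups

* `Units.nonarchimedeanGroup_of_openSubmonoid_basis` — if every neighbourhood of `1` in a topological
  monoid `M` contains an OPEN SUBMONOID, then `Mˣ` (units topology) is a nonarchimedean group.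
* `Pi.instNonarchimedeanGroup` — products of nonarchimedean groups are nonarchimedean.
* `Valued.instNonarchimedeanGroupUnitsValuationSubring` — for a valued field `R`, `𝒪_R^×` is
  nonarchimedean (open submonoids `{x ∈ 𝒪 : v(x - 1) < γ}`).
* instances for `(v.adicCompletionIntegers K)ˣ` and for `(Π v, v.adicCompletionIntegers K)ˣ`
  (the latter via `ContinuousMulEquiv.piUnits`).
-/

set_option autoImplicit false

noncomputable section

open Topology Filter Set

/-! ## Units of a monoid with a basis of open submonoids -/

namespace Units

/-- If every neighbourhood of `1` in a topological monoid contains an open submonoid, the group of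
units (with its units topology) is a nonarchimedean group: the open subgroups are `W.units` for the
open submonoids `W`. -/
alias nonarchimedeanGroup_of_openSubmonoid_basis := Literature.Topology.Algebra.Units.nonarchimedeanGroup_of_openSubmonoid_basis

end Units

/-! ## Products -/

/-- (Ported verbatim from the HodgeCMPerL package; no docstring in the source.) -/
instance Pi.instNonarchimedeanGroup {ι : Type*} {G : ι → Type*} [∀ i, Group (G i)]
    [∀ i, TopologicalSpace (G i)] [∀ i, NonarchimedeanGroup (G i)] :
    NonarchimedeanGroup (∀ i, G i) where
  is_nonarchimedean U hU := by
    rw [nhds_pi, Filter.mem_pi] at hU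
    obtain ⟨I, hI, t, ht, hts⟩ := hU
    choose V hV using fun i => NonarchimedeanGroup.is_nonarchimedean (t i) (ht i)
    refine ⟨hI.toFinset.inf fun i => (V i).comap (Pi.evalMonoidHom G i) (continuous_apply i), ?_⟩
    intro x hx
    apply hts
    intro i hi
    apply hV i
    have hle : (hI.toFinset.inf fun i => (V i).comap (Pi.evalMonoidHom G i) (continuous_apply i)) ≤
        (V i).comap (Pi.evalMonoidHom G i) (continuous_apply i) :=
      Finset.inf_le (hI.mem_toFinset.mpr hi)
    exact OpenSubgroup.mem_comap.mp (hle hx)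

/-- Transport along a topological group isomorphism. -/
alias NonarchimedeanGroup.of_continuousMulEquiv := Literature.Topology.Algebra.NonarchimedeanGroup.of_continuousMulEquiv

/-! ## Units of the valuation ring of a valued field -/

namespace Valued

variable {R : Type*} [Field R] {Γ₀ : Type*} [LinearOrderedCommGroupWithZero Γ₀] [hv : Valued R Γ₀]

/-- (Ported verbatim from the HodgeCMPerL package; no docstring in the source.) -/
instance instIsTopologicalRingValuationSubring :
    IsTopologicalRing (hv.v.valuationSubring : ValuationSubring R) :=
  inferInstanceAs (IsTopologicalRing (hv.v.valuationSubring : ValuationSubring R).toSubring)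

/-- The open submonoid `{x ∈ 𝒪 : v(x - 1) < γ}` of the valuation ring. -/
def unitBall (γ : (MonoidWithZeroHom.ValueGroup₀ (.ofClass (hv.v : Valuation R Γ₀)))ˣ) :
    Submonoid (hv.v.valuationSubring : ValuationSubring R) where
  carrier := {x | hv.v.restrict ((x : R) - 1) < γ}
  one_mem' := by
    simp only [Set.mem_setOf_eq, OneMemClass.coe_one, sub_self, map_zero]
    exact γ.zero_lt
  mul_mem' := by
    intro x y hx hy
    simp only [Set.mem_setOf_eq] at hx hy ⊢
    have hy1 : hv.v.restrict (y : R) ≤ 1 :=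
      (Valuation.restrict_le_one_iff _).mpr ((Valuation.mem_valuationSubring_iff _ _).mp y.2)
    have h1 : hv.v.restrict (((x : R) - 1) * (y : R)) < γ := by
      rw [map_mul]
      calc hv.v.restrict ((x : R) - 1) * hv.v.restrict (y : R)
          ≤ hv.v.restrict ((x : R) - 1) * 1 := by gcongr
        _ = hv.v.restrict ((x : R) - 1) := mul_one _
        _ < γ := hx
    have h := Valuation.map_add_lt _ h1 hy
    have heq : ((x : R) - 1) * (y : R) + ((y : R) - 1) = (x : R) * (y : R) - 1 := by ring
    rw [heq] at h
    simpa using h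

/-- (Ported verbatim from the HodgeCMPerL package; no docstring in the source.) -/
theorem mem_unitBall {γ : (MonoidWithZeroHom.ValueGroup₀ (.ofClass (hv.v : Valuation R Γ₀)))ˣ}
    {x : (hv.v.valuationSubring : ValuationSubring R)} :
    x ∈ unitBall γ ↔ hv.v.restrict ((x : R) - 1) < γ := Iff.rfl

/-- (Ported verbatim from the HodgeCMPerL package; no docstring in the source.) -/
alias isOpen_setOf_sub_one_lt := Literature.Topology.Algebra.Valued.isOpen_setOf_sub_one_lt

/-- (Ported verbatim from the HodgeCMPerL package; no docstring in the source.) -/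
theorem isOpen_unitBall (γ : (MonoidWithZeroHom.ValueGroup₀ (.ofClass (hv.v : Valuation R Γ₀)))ˣ) :
    IsOpen (unitBall γ : Set (hv.v.valuationSubring : ValuationSubring R)) :=
  (isOpen_setOf_sub_one_lt γ).preimage continuous_subtype_val

/-- (Ported verbatim from the HodgeCMPerL package; no docstring in the source.) -/
theorem exists_unitBall_subset {N : Set (hv.v.valuationSubring : ValuationSubring R)}
    (hN : N ∈ 𝓝 (1 : (hv.v.valuationSubring : ValuationSubring R))) :
    ∃ γ : (MonoidWithZeroHom.ValueGroup₀ (.ofClass (hv.v : Valuation R Γ₀)))ˣ,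
      (unitBall γ : Set (hv.v.valuationSubring : ValuationSubring R)) ⊆ N := by
  rw [nhds_subtype, Filter.mem_comap] at hN
  obtain ⟨N', hN', hsub⟩ := hN
  rw [OneMemClass.coe_one, Valued.mem_nhds] at hN'
  obtain ⟨γ, hγ⟩ := hN'
  exact ⟨γ, fun x hx => hsub (hγ hx)⟩

/-- **`𝒪^×` has no small subgroups obstruction**: the unit group of the valuation ring of a valued
field is a nonarchimedean group. -/
instance instNonarchimedeanGroupUnitsValuationSubring :
    NonarchimedeanGroup (hv.v.valuationSubring : ValuationSubring R)ˣ :=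
  Units.nonarchimedeanGroup_of_openSubmonoid_basis fun N hN => by
    obtain ⟨γ, hγ⟩ := exists_unitBall_subset hN
    exact ⟨unitBall γ, isOpen_unitBall γ, hγ⟩

end Valued

/-! ## `𝒪_v^×` and `∏_v 𝒪_v^×` for a Dedekind domain -/

namespace IsDedekindDomain.HeightOneSpectrum

variable (R : Type*) [CommRing R] [IsDedekindDomain R] (K : Type*) [Field K] [Algebra R K]
  [IsFractionRing R K] (v : HeightOneSpectrum R)

/-- (Ported verbatim from the HodgeCMPerL package; no docstring in the source.) -/
instance instIsTopologicalRingAdicCompletionIntegers :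
    IsTopologicalRing (v.adicCompletionIntegers K) :=
  Valued.instIsTopologicalRingValuationSubring

/-- `𝒪_v^×` is a nonarchimedean group. -/
instance instNonarchimedeanGroupUnitsAdicCompletionIntegers :
    NonarchimedeanGroup (v.adicCompletionIntegers K)ˣ :=
  Valued.instNonarchimedeanGroupUnitsValuationSubring

/-- `(∏_v 𝒪_v)^× ≅ ∏_v 𝒪_v^×` is a nonarchimedean group. -/
instance instNonarchimedeanGroupUnitsPiAdicCompletionIntegers :
    NonarchimedeanGroup (Π w : HeightOneSpectrum R, w.adicCompletionIntegers K)ˣ :=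
  NonarchimedeanGroup.of_continuousMulEquiv
    (ContinuousMulEquiv.piUnits (M := fun w : HeightOneSpectrum R => w.adicCompletionIntegers K)).symm

end IsDedekindDomain.HeightOneSpectrum

end
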